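import Literature.MathematicalPhysics.QuantumFieldTheory.Balaban1983to89.B9Eq335CoverageWindow
import Literature.MathematicalPhysics.QuantumFieldTheory.Balaban1983to89.B9BackgroundsKLevelV1P

/-!
# `Balaban1983to89.B9Eq335CoveragePAtLettersY` — T. Bałaban, *Propagators for lattice gauge theories in a background field*, Commun. Math. Phys. **99** (1985)
# 389–434 [Balaban1985BackgroundPropagators] p. 396 (the cube class of (3.35), «O(1) ≧ 10») with (3.69) p. 404 («b ∈ Ω_j … follow directly from the assumptions
# (3.35)»): EVERY PLAQUETTE IS COVERED BY PRINT'S CUBE CLASS (def-Y's `B9BackgroundsKLevelV1P.cubeClassP`, p531304), hence (3.35) BOUNDS EVERY PLAQUETTE VARIABLE, and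
# ROW 17's ONE DISPLAYED CLAUSE is reduced to the principal coercivity with NO coverage binder (the (ii) side of this seat's split DISCHARGED at the letters of record)

statement-level skeleton of published theorems with citation tags; proofs where landed; nothing here is a claim about the Yang–Mills mass gap

THE PRINT (verbatim, p. 396).  *«For each cube □ of this class there exists a unique index j, 0 ≤ j ≤ k, such that □ ⊂ Bʲ(Λ_j) ∪ B^{j+1}(Λ_{j+1}), □ ∩ Bʲ(Λ_j) ≠ ∅, and □ is a
union of several big blocks of the lattice T_{Lʲη}, which implies that its size in the lattice T_η is O(1)MLʲη. Here O(1) will mean a number ≧ 10.»*  p. 404: *«… the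
estimates [|Re U(∂p) − 1| ≤ …, |Im U(∂p)| ≤ …] follow directly from the assumptions (3.35), (3.37).»* (the bracketed insertion is OURS: it names the two displayed
bounds of (3.69) p. 404 L15, of size O(1)Mα₀(Lʲη)⁻² for plaquettes in Bʲ, which the sentence refers to; everywhere below «|U(∂p) − 1| ≤ O(1)Mα₀(Lʲη)⁻²» is our
PARAPHRASE of those two bounds, not a printed line — v1.2 doc-only note, referee ref-A g30 NIT-CITE-1).
EDITIONS.  v1.0 (g11, 2026-08-27) §1–§3; v1.1 (g23, p633293, 2026-08-28) + §4 the levelled bound; v1.2 (g25, 2026-08-28) DOC-ONLY: NIT-CITE-1 re-marking in this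
header and in the docstring of `norm_holY_sub_one_le_levelled_of_reg335P` — every declaration, statement and proof byte-identical to v1.1.

WHY THIS FILE (cell context).  LOCATED-COVERAGE-1 (this seat) → dag-lead DESK WORD («holder of the coverage lemma = n06-j») → lit-balaban r06 LOC-RELAY-2 (print's «≧ 10»,
the tacit step (T1) «every bond of Ω_j with its plaquettes lies in a class cube») → node00-def-Y g7 (R289) LANDED-16 `B9BackgroundsKLevelV1P`: print's class `cubeClassP i c`
(triples `(□, j, n)`, `c ≤ n` open-ended, per-cube constant `n·(M·α₀)`, level window `{j, j+1}`, «meets level j»), carriers `bg9KP ∕ bg9YP`, and the N06 certificate's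
edition-7 premise `(bg9YP …).Reg335 c35Y α₀ U`.  This file proves (T1) for that class and closes the (ii) side of row 17's clause at it.
THE ARGUMENT (★★★ `exists_cubeClassP_plaquette`).  For a site `x` of level `j`, take the aligned cube `Q` of `10` big `j`-blocks cornered at `x`'s block: it contains
`x, x+e_μ, x+e_ν, x+e_μ+e_ν` (`B9Eq335CoverageWindow.plaquette_mem_torusCube_two_mul`), and by (2.2) (`levV1_window`, `10L ≤ 2L² ≤ R`) all its levels lie in
`{j−1, j, j+1}`.  If no site of level `j−1` occurs, `(Q, j, 10)` is a class triple.  Otherwise no site of level `j+1` occurs either ((2.2) at level `j`, `R ≥ 10`), and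
`Q` is a union of `10L` big `(j−1)`-blocks meeting level `j−1`: `(Q, j−1, 10L)` is a class triple.  Either way the threshold `c ≤ 10` is met and the size is `≤ 10L`.
WHAT IS PROVED (sorry-free; 0 `def`; nothing of [B9] asserted).
* §1 `exists_block_corner` (def-Y's corner construction exposed), ★★★ **`exists_cubeClassP_plaquette`** (`c ≤ 10` ⇒ `∃ q ∈ cubeClassP i c` containing the plaquette's four
  sites, with `q.2.1 ∈ {lev x, lev x − 1}` and `q.2.2 ≤ 10·L`).
* §2 `plaqBound_mono`, ★★★ **`norm_holY_sub_one_le_of_reg335P`** (`(bg9KP (M_N(ℂ)) G i).Reg335 c α₀ U`, `c ≤ 10`, `M·α₀ ≥ 0`, `N ≥ 1` ⇒ for EVERY plaquette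
  `|U(∂p) − 1| ≤ 2K(1+K)e^{4K}`, `K = 10L·(M·α₀)` — via def-Y's `reg335CubeP_of_reg335P` and this seat's class-independent `norm_holY_sub_one_le_of_reg335Cube`), ★★★
  **`posDefTr_deltaAY_parSymY_of_principal_P`** (`G ≤ U(N)`, the same class membership, principal coercivity with `γ > 12(d+1)c_f²·2K(1+K)e^{4K}` ⇒
  `PosDefTr 1 (deltaAY i (parSymY i) (parBY i) (GpY i (parSymY i)) U)` — file 2's reduction with the plaquette smallness PROVED).
MODEL ∕ DECLARED READINGS.  def-Y's letters and P-class at a k-level index; the uniform bound forgets the scale factor `L^{−2j′}` (kept in `norm_holY_sub_one_le_of_reg335Cube`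
for the local form `trIP_hessY_ge`); constants are witnesses, not optimised.  DISPLAYED: the principal coercivity `γ` (Thm 3.3 ∕ [4] content) — nothing else.
HONEST SCOPE.  Lattice geometry + bookkeeping; `hΔA` is now reduced, at print's class, to the principal coercivity ALONE; NOT a node discharge, NOT summit progress;
count-neutral; nothing continuum ∕ OS ∕ mass gap ∕ Clay.  Cell `pub-ymgap` (HUMAN RULING D-0062), Track A node N06 [B9], seat `pub-ymgap-dag-n06-j` (bundle F5; harness
re-seat gen 11), 2026-08-27.  NEW file importing `B9Eq335CoverageWindow` + def-Y's `B9BackgroundsKLevelV1P`; nothing landed is modified.  Net new unproved facts: 0.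
-/

noncomputable section

namespace Literature.MathematicalPhysics.QuantumFieldTheory.Balaban1983to89.B9Eq335CoveragePAtLettersY

open Literature.MathematicalPhysics.QuantumFieldTheory.Balaban1983to89
open B6KLevelCensusIndexV1 B9BackgroundsKLevelV1 B6GlobalChartV1 Node00 B9BackgroundsKLevelV1P B9Eq335CoverageWindow
open scoped Matrix

section Coverage

variable {d ℓ : ℕ} {hd : 1 ≤ d + 1} {hL : Odd (ℓ + 1) ∧ 1 < ℓ + 1} {b₀ b₁ : ℝ}
variable (i : KIdx d ℓ hd hL b₀ b₁)

/-- the big-`j`-block corner of a site and the membership of the site in its block (def-Y's `exists_mem_cubeClass396` construction, exposed).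
[cite: Balaban1985BackgroundPropagators, p.396 (the big blocks); Balaban1984PropagatorsII, (2.1) p.224] -/
theorem exists_block_corner (x : Site (PV d ℓ i.m i.K hd hL) 0) (j : ℕ) (hjk : j ≤ i.k) :
    ∃ c : Site (PV d ℓ i.m i.K hd hL) 0, (∀ μ, B6MultiLevelBoxOperator.bigSide ℓ i.Mh j ∣ (c μ).val) ∧ x ∈ torusCube c (B6MultiLevelBoxOperator.bigSide ℓ i.Mh j) := by
  set s := B6MultiLevelBoxOperator.bigSide ℓ i.Mh j with hsdef
  have h8 : 8 ≤ i.Mh := i.hM8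
  have hs : 0 < s := by rw [hsdef]; unfold B6MultiLevelBoxOperator.bigSide; positivity
  have hN : (PV d ℓ i.m i.K hd hL).sitesPerDir 0 = B6MultiLevelBoxOperator.bigSide ℓ i.Mh i.k * i.P' 0 := by
    rw [← i.hN 0, B6MultiLevelTorusOperator.N0_eq_bigSide_mul]
  have hsk : s ∣ B6MultiLevelBoxOperator.bigSide ℓ i.Mh i.k := ⟨(ℓ + 1) ^ (i.k - j), by rw [hsdef]; exact bigSide_eq_mul_pow hjk⟩
  have hsN : s ∣ (PV d ℓ i.m i.K hd hL).sitesPerDir 0 := by rw [hN]; exact dvd_mul_of_dvd_left hsk _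
  let c : Site (PV d ℓ i.m i.K hd hL) 0 := fun μ => ((s * ((x μ).val / s) : ℕ) : ZMod _)
  have hcval : ∀ μ, (c μ).val = s * ((x μ).val / s) := by
    intro μ
    show ((((s * ((x μ).val / s) : ℕ)) : ZMod ((PV d ℓ i.m i.K hd hL).sitesPerDir 0))).val = _
    rw [ZMod.val_natCast, Nat.mod_eq_of_lt]
    exact lt_of_le_of_lt (Nat.mul_div_le _ _) (ZMod.val_lt _)
  have hc : ∀ μ, s ∣ (c μ).val := fun μ => ⟨(x μ).val / s, hcval μ⟩
  refine ⟨c, hc, ?_⟩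
  rw [mem_torusCube_iff_blk i hs hsN c hc, blk_toBox_eq_iff]
  intro μ
  rw [hcval, Nat.mul_div_cancel_left _ hs]

/-- ★★★ **EVERY PLAQUETTE IS COVERED BY PRINT'S CUBE CLASS** (def-Y's `cubeClassP`, threshold `c ≤ 10`): for every site `x` and directions `μ, ν` there is a class
triple `(□, j′, n)` with `{x, x+e_μ, x+e_ν, x+e_μ+e_ν} ⊆ □`, index `j′ ∈ {lev x, lev x − 1}` and size `n ≤ 10·L` — namely the aligned cube of `10` big `(lev x)`-blocks
cornered at `x`'s block: by the collar axiom (2.2) its levels lie in `{lev x − 1, lev x, lev x + 1}` (`levV1_window`, `10L ≤ 2L² ≤ R`), and EITHER no site of level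
`lev x − 1` occurs (index `lev x`, size `10`) OR one does, and then no site of level `lev x + 1` occurs either ((2.2) again, `R ≥ 10`) and the same cube is a union of
`10L` big `(lev x − 1)`-blocks meeting level `lev x − 1` (index `lev x − 1`, size `10L`).  This is the tacit step behind p. 404's «b ∈ Ω_j … follow directly from the
assumptions (3.35)» (lit-balaban r06 LOC-RELAY-2 (T1)). [cite: Balaban1985BackgroundPropagators, p.396 (the class), (3.69) p.404; Balaban1984PropagatorsII, (2.2) p.224] -/
theorem exists_cubeClassP_plaquette {c : ℝ} (hc : c ≤ 10) (x : Site (PV d ℓ i.m i.K hd hL) 0) (μ ν : Fin (PV d ℓ i.m i.K hd hL).d) :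
    ∃ q ∈ cubeClassP i c, (x ∈ q.1 ∧ x.shift μ ∈ q.1 ∧ x.shift ν ∈ q.1 ∧ (x.shift μ).shift ν ∈ q.1) ∧
      (q.2.1 = levV1 i x ∨ q.2.1 + 1 = levV1 i x) ∧ q.2.2 ≤ 10 * (ℓ + 1) := by
  classical
  set j := levV1 i x with hjdef
  set S := B6MultiLevelBoxOperator.bigSide ℓ i.Mh j with hSdef
  have hj1 : 1 ≤ j := levV1_pos i x
  have hjk : j ≤ i.k := levV1_le i x
  have h8 : 8 ≤ i.Mh := i.hM8
  have hℓ : 4 ≤ ℓ := i.hℓ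
  have hR : 2 * (ℓ + 1) ^ 2 ≤ i.R := i.hR2
  have hS2 : 2 ≤ S := by
    rw [hSdef]; unfold B6MultiLevelBoxOperator.bigSide
    calc 2 ≤ 8 * 1 := by norm_num
      _ ≤ i.Mh * (ℓ + 1) ^ (j + 1) := Nat.mul_le_mul h8 (Nat.one_le_pow _ _ (Nat.succ_pos ℓ))
  obtain ⟨c₀, hc₀, hx₀⟩ := exists_block_corner i x j hjk
  -- the 10-cube `Q`
  have h10R : 10 * (ℓ + 1) ≤ i.R := le_trans (by nlinarith) hR
  have hxQ : x ∈ torusCube c₀ (10 * S) := torusCube_mono c₀ (by omega) hx₀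
  obtain ⟨-, hμ2, hν2, hμν2⟩ := plaquette_mem_torusCube_two_mul hS2 hx₀ μ ν
  have hsub : torusCube c₀ (2 * S) ⊆ torusCube c₀ (10 * S) := torusCube_mono c₀ (by omega)
  have hwin : ∀ y ∈ torusCube c₀ (10 * S), j ≤ levV1 i y + 1 ∧ levV1 i y ≤ j + 1 := fun y hy => levV1_window i h10R hxQ hy
  by_cases hlow : ∃ y ∈ torusCube c₀ (10 * S), levV1 i y + 1 = j
  · -- CASE B: a site of level `j − 1` occurs ⇒ no site of level `j + 1` (sepT at level `j`), index `j − 1`, size `10L`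
    obtain ⟨y, hy, hylev⟩ := hlow
    have hy1 : 1 ≤ levV1 i y := levV1_pos i y
    have hnoup : ∀ z ∈ torusCube c₀ (10 * S), levV1 i z ≤ j := by
      intro z hz
      by_contra hzl
      push Not at hzl
      have hyl : i.D.lev (toBox i.hN y).1 = levV1 i y := rfl
      have hzl : i.D.lev (toBox i.hN z).1 = levV1 i z := rfl
      have hsep := i.D.sepT j (toBox i.hN y).1 (toBox i.hN y).2 (toBox i.hN z).1 (toBox i.hN z).2
        (by rw [hyl]; omega) (by rw [hzl]; omega)
      have hd' := torusSupNorm_lt_of_mem_torusCube i hy hz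
      have hlt : i.R * S < 10 * S := by exact_mod_cast lt_trans hsep hd'
      have : 10 ≤ i.R := le_trans (by nlinarith) h10R
      nlinarith
    have hS' : S = (ℓ + 1) * B6MultiLevelBoxOperator.bigSide ℓ i.Mh (j - 1) := by
      rw [hSdef]; unfold B6MultiLevelBoxOperator.bigSide
      rw [show j + 1 = (j - 1 + 1) + 1 by omega, pow_succ]; ring
    refine ⟨(torusCube c₀ (10 * S), j - 1, 10 * (ℓ + 1)), ?_, ⟨hxQ, hsub hμ2, hsub hν2, hsub hμν2⟩, Or.inr (show j - 1 + 1 = levV1 i x by omega), le_rfl⟩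
    have hcube : torusCube c₀ (10 * S) = torusCube c₀ ((10 * (ℓ + 1)) * B6MultiLevelBoxOperator.bigSide ℓ i.Mh (j - 1)) := by
      rw [hS']; ring_nf
    rw [hcube]
    refine alignedCube_mem_cubeClassP i (j := j - 1) (n := 10 * (ℓ + 1)) (by omega) (by omega) (by omega) ?_ c₀ ?_ ?_ ?_
    · calc c ≤ 10 := hc
        _ ≤ ((10 * (ℓ + 1) : ℕ) : ℝ) := by exact_mod_cast (by omega : 10 ≤ 10 * (ℓ + 1))
    · intro κ
      exact dvd_trans (Dvd.intro_left _ hS'.symm) (hc₀ κ)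
    · intro z hz
      rw [← hcube] at hz
      have h1 := hwin z hz
      have h2 := hnoup z hz
      omega
    · exact ⟨y, by rw [← hcube]; exact hy, by omega⟩
  · -- CASE A: no site of level `j − 1` ⇒ levels in `{j, j+1}`, index `j`, size `10`
    push Not at hlow
    refine ⟨(torusCube c₀ (10 * S), j, 10), ?_, ⟨hxQ, hsub hμ2, hsub hν2, hsub hμν2⟩, Or.inl rfl, show 10 ≤ 10 * (ℓ + 1) by omega⟩
    refine alignedCube_mem_cubeClassP i hj1 hjk (by norm_num) (by exact_mod_cast hc) c₀ hc₀ ?_ ⟨x, hxQ, rfl⟩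
    intro z hz
    have h1 := hwin z hz
    have h2 := hlow z hz
    omega

end Coverage

/-! ## §2 (3.69)'s plaquette estimate for EVERY plaquette from print's class (3.35), and row 17's clause reduced with NO coverage binder -/

section PlaquetteData

open scoped Matrix.Norms.L2Operator
open B9Eq335PlaquetteAtLettersY B9Thm311PosOfPrincipalAtLettersY B9Thm311ReadingCoords

variable {d ℓ : ℕ} {hd : 1 ≤ d + 1} {hL : Odd (ℓ + 1) ∧ 1 < ℓ + 1} {b₀ b₁ : ℝ} {N : ℕ}
variable (i : KIdx d ℓ hd hL b₀ b₁)

/-- the plaquette-bound function `C ↦ 2C(1+C)e^{4C}` is monotone on `C ≥ 0`. [cite: Balaban1985BackgroundPropagators, (3.35) p.396, bookkeeping] -/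
theorem plaqBound_mono {C C' : ℝ} (hC : 0 ≤ C) (hCC : C ≤ C') :
    2 * C * (1 + C) * Real.exp (4 * C) ≤ 2 * C' * (1 + C') * Real.exp (4 * C') := by
  have h1 : Real.exp (4 * C) ≤ Real.exp (4 * C') := Real.exp_le_exp.2 (by linarith)
  have h2 : 0 ≤ Real.exp (4 * C) := (Real.exp_pos _).le
  have h3 : 2 * C * (1 + C) ≤ 2 * C' * (1 + C') := by nlinarith
  calc 2 * C * (1 + C) * Real.exp (4 * C) ≤ 2 * C' * (1 + C') * Real.exp (4 * C) := mul_le_mul_of_nonneg_right h3 h2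
    _ ≤ 2 * C' * (1 + C') * Real.exp (4 * C') := mul_le_mul_of_nonneg_left h1 (by nlinarith)

/-- ★★★ **PRINT'S (3.35) BOUNDS EVERY PLAQUETTE** (def-Y's `bg9KP`, threshold `c ≤ 10`, `M·α₀ ≥ 0`, `N ≥ 1`): with `K := 10·L·(M·α₀)`,
`|U(∂p) − 1| ≤ 2K(1+K)e^{4K}` for EVERY plaquette `p` — §1's covering cube (size `n ≤ 10L`, index `lev x` or `lev x − 1`) carries the per-cube datum
(`reg335CubeP_of_reg335P`), and this seat's class-independent `norm_holY_sub_one_le_of_reg335Cube` reads the plaquette off it; p. 404's «the estimates follow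
directly from the assumptions (3.35)» with NO coverage hypothesis left. [cite: Balaban1985BackgroundPropagators, (3.69) p.404, (3.35) p.396] -/
theorem norm_holY_sub_one_le_of_reg335P [Nonempty (Fin N)] {G : Subgroup (Matrix (Fin N) (Fin N) ℂ)ˣ} (U : CfgY (Matrix (Fin N) (Fin N) ℂ) i)
    {c α₀ : ℝ} (hc : c ≤ 10) (hMα : 0 ≤ (kGeo i).M * α₀) (h : (bg9KP (Matrix (Fin N) (Fin N) ℂ) G i).Reg335 c α₀ U) (p : PlaqY i) :
    ‖((holY i U p : (Matrix (Fin N) (Fin N) ℂ)ˣ) : Matrix (Fin N) (Fin N) ℂ) - 1‖ ≤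
      2 * (10 * (kGeo i).L * ((kGeo i).M * α₀)) * (1 + 10 * (kGeo i).L * ((kGeo i).M * α₀)) * Real.exp (4 * (10 * (kGeo i).L * ((kGeo i).M * α₀))) := by
  obtain ⟨q, hq, ⟨hx, hxμ, hxν, -⟩, -, hn⟩ := exists_cubeClassP_plaquette i hc p.src p.μ p.ν
  have hcube := reg335CubeP_of_reg335P (𝔸 := Matrix (Fin N) (Fin N) ℂ) (G := G) i h hq
  have hη := eta_pos i
  have hL1 := one_le_L i
  have hj : (kGeo i).eta ≤ LatticeNorms.scaleLen (kGeo i).L (kGeo i).eta q.2.1 := by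
    unfold LatticeNorms.scaleLen
    have : (1 : ℝ) ≤ (kGeo i).L ^ q.2.1 := one_le_pow₀ hL1
    nlinarith
  have hC0 : 0 ≤ (q.2.2 : ℝ) * ((kGeo i).M * α₀) := mul_nonneg (Nat.cast_nonneg _) hMα
  have key := norm_holY_sub_one_le_of_reg335Cube i U hη hj hC0 hcube p hx hxμ hxν
  have hratio : ((kGeo i).eta / LatticeNorms.scaleLen (kGeo i).L (kGeo i).eta q.2.1) ^ 2 ≤ 1 := by
    have hpos : 0 < LatticeNorms.scaleLen (kGeo i).L (kGeo i).eta q.2.1 := lt_of_lt_of_le hη hj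
    have h01 : (kGeo i).eta / LatticeNorms.scaleLen (kGeo i).L (kGeo i).eta q.2.1 ≤ 1 := (div_le_one hpos).2 hj
    have h00 : 0 ≤ (kGeo i).eta / LatticeNorms.scaleLen (kGeo i).L (kGeo i).eta q.2.1 := div_nonneg hη.le hpos.le
    nlinarith
  have hnL : (q.2.2 : ℝ) ≤ 10 * (kGeo i).L := by
    show (q.2.2 : ℝ) ≤ 10 * ((ℓ + 1 : ℕ) : ℝ)
    exact_mod_cast hn
  have hCC : (q.2.2 : ℝ) * ((kGeo i).M * α₀) ≤ 10 * (kGeo i).L * ((kGeo i).M * α₀) := mul_le_mul_of_nonneg_right hnL hMα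
  have hmono := plaqBound_mono hC0 hCC
  have hB0 : 0 ≤ 2 * ((q.2.2 : ℝ) * ((kGeo i).M * α₀)) * (1 + (q.2.2 : ℝ) * ((kGeo i).M * α₀)) * Real.exp (4 * ((q.2.2 : ℝ) * ((kGeo i).M * α₀))) := by
    have := Real.exp_pos (4 * ((q.2.2 : ℝ) * ((kGeo i).M * α₀))); positivity
  calc _ ≤ 2 * ((q.2.2 : ℝ) * ((kGeo i).M * α₀)) * (1 + (q.2.2 : ℝ) * ((kGeo i).M * α₀)) * Real.exp (4 * ((q.2.2 : ℝ) * ((kGeo i).M * α₀))) *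
        ((kGeo i).eta / LatticeNorms.scaleLen (kGeo i).L (kGeo i).eta q.2.1) ^ 2 := key
    _ ≤ 2 * ((q.2.2 : ℝ) * ((kGeo i).M * α₀)) * (1 + (q.2.2 : ℝ) * ((kGeo i).M * α₀)) * Real.exp (4 * ((q.2.2 : ℝ) * ((kGeo i).M * α₀))) * 1 :=
        mul_le_mul_of_nonneg_left hratio hB0
    _ ≤ _ := by rw [mul_one]; exact hmono

/-- ★★★ **ROW 17's CLAUSE OVER PRINT'S CLASS, (ii) DISCHARGED**: at a `G`-valued background (`G ≤ U(N)`) in def-Y's `(bg9KP (M_N(ℂ)) G i).Reg335 c α₀` (`c ≤ 10`,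
`M·α₀ ≥ 0`), with `δ := 2K(1+K)e^{4K}`, `K = 10L·M·α₀`, def-Y's `Δ_a(U)` is positive definite as soon as the principal gauge-fixed form is coercive with
`γ > 12(d+1)·c_f²·δ` — file 2's `posDefTr_deltaAY_parSymY_of_principal` with the plaquette smallness now PROVED for every plaquette (no coverage binder).
The principal coercivity (Thm 3.3 ∕ [4]) stays displayed. [cite: Balaban1985BackgroundPropagators, Thm 3.11 p.416, (3.26) p.395, (3.35) p.396, (3.69) p.404] -/
theorem posDefTr_deltaAY_parSymY_of_principal_P [Nonempty (Fin N)] {G : Subgroup (Matrix (Fin N) (Fin N) ℂ)ˣ}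
    (hG : G ≤ B7Prop2Explicit.unitaryUnits (Matrix (Fin N) (Fin N) ℂ)) {U : CfgY (Matrix (Fin N) (Fin N) ℂ) i}
    {c α₀ : ℝ} (hc : c ≤ 10) (hMα : 0 ≤ (kGeo i).M * α₀) (h : (bg9KP (Matrix (Fin N) (Fin N) ℂ) G i).Reg335 c α₀ U) {γ : ℝ}
    (hcoer : ∀ A : FBondY i → Matrix (Fin N) (Fin N) ℂ,
      γ * trIP (fun _ => (1 : ℝ)) A A ≤
        (1 - 2 * (10 * (kGeo i).L * ((kGeo i).M * α₀)) * (1 + 10 * (kGeo i).L * ((kGeo i).M * α₀)) * Real.exp (4 * (10 * (kGeo i).L * ((kGeo i).M * α₀)))) *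
            trIP (fun _ => (1 : ℝ)) (curlY i U A) (curlY i U A)
        + trIP (fun _ => (1 : ℝ)) (divY i U A) (RY i (parSymY i) (GpY i (parSymY i)) U (divY i U A))
        + trIP i.w (QY i (parBY i) U A) (QY i (parBY i) U A))
    (hγ : 12 * (d + 1) * i.cf ^ 2 * (2 * (10 * (kGeo i).L * ((kGeo i).M * α₀)) * (1 + 10 * (kGeo i).L * ((kGeo i).M * α₀)) *
      Real.exp (4 * (10 * (kGeo i).L * ((kGeo i).M * α₀)))) < γ) :
    PosDefTr (fun _ => (1 : ℝ)) (deltaAY i (parSymY i) (parBY i) (GpY i (parSymY i)) U) := by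
  have hU : ∀ μ x, U μ x ∈ G := h.1
  have hδ0 : 0 ≤ 2 * (10 * (kGeo i).L * ((kGeo i).M * α₀)) * (1 + 10 * (kGeo i).L * ((kGeo i).M * α₀)) *
      Real.exp (4 * (10 * (kGeo i).L * ((kGeo i).M * α₀))) := by
    have hL0 : 0 ≤ (kGeo i).L := le_trans zero_le_one (one_le_L i)
    have := Real.exp_pos (4 * (10 * (kGeo i).L * ((kGeo i).M * α₀)))
    positivity
  exact posDefTr_deltaAY_parSymY_of_principal i hG hU hδ0 (fun p => norm_holY_sub_one_le_of_reg335P i U hc hMα h p) hcoer hγ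

end PlaquetteData

/-! ## §3 The member-level face for the N06 certificate (edition 7 premise `(bg9YP …).Reg335 c35Y α₀ U`) -/

section MemberFace

open scoped Matrix.Norms.L2Operator
open B9Thm311PosOfPrincipalAtLettersY B9Thm311ReadingCoords B9PinMembersKLevelV1 B9PinGeometryKLevelV1 B7Prop2SpecialUnitary

variable {d ℓ : ℕ} {hd : 1 ≤ d + 1} {hL : Odd (ℓ + 1) ∧ 1 < ℓ + 1} {b₀ b₁ : ℝ} {Mstar N : ℕ}

/-- ★★★ **ROW 17's CLAUSE AT A MEMBER, FROM THE PRINCIPAL COERCIVITY ALONE** (certificate edition 7's premise `(bg9YP (M_N(ℂ)) SU(N) x).Reg335 c35Y α₀ U`, `α₀ ≥ 0`,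
`N ≥ 1`): with `K := 10·L·M·α₀` (`L = (kGeo x.toKIdx).L`, `M = (kGeo x.toKIdx).M = (geo9Y x).M`) and `δ := 2K(1+K)e^{4K}`, if the principal gauge-fixed form of (3.26) is
coercive with `γ > 12(d+1)·c_f²·δ` then `PosDefTr 1 (deltaAY x.toKIdx (parSymY _) (parBY _) (GpY _ (parSymY _)) U)` — the plaquette smallness comes from (3.35) for EVERY
plaquette (§2), the coverage from §1; only the coercivity (Thm 3.3 ∕ [4]) is displayed. [cite: Balaban1985BackgroundPropagators, Thm 3.11 p.416, (3.35) p.396, (3.69) p.404] -/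
theorem posDefTr_deltaAY_member_of_principal_P [Nonempty (Fin N)] (x : MemberY d ℓ hd hL b₀ b₁ Mstar) {α₀ : ℝ} (hα₀ : 0 ≤ α₀)
    {U : (bg9YP (Matrix (Fin N) (Fin N) ℂ) (specialUnitaryUnits (Fin N)) x).Cfg}
    (h : (bg9YP (Matrix (Fin N) (Fin N) ℂ) (specialUnitaryUnits (Fin N)) x).Reg335 c35Y α₀ U) {γ : ℝ}
    (hcoer : ∀ A : FBondY x.toKIdx → Matrix (Fin N) (Fin N) ℂ,
      γ * trIP (fun _ => (1 : ℝ)) A A ≤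
        (1 - 2 * (10 * (kGeo x.toKIdx).L * ((kGeo x.toKIdx).M * α₀)) * (1 + 10 * (kGeo x.toKIdx).L * ((kGeo x.toKIdx).M * α₀)) *
              Real.exp (4 * (10 * (kGeo x.toKIdx).L * ((kGeo x.toKIdx).M * α₀)))) *
            trIP (fun _ => (1 : ℝ)) (curlY x.toKIdx U A) (curlY x.toKIdx U A)
        + trIP (fun _ => (1 : ℝ)) (divY x.toKIdx U A) (RY x.toKIdx (parSymY x.toKIdx) (GpY x.toKIdx (parSymY x.toKIdx)) U (divY x.toKIdx U A))
        + trIP x.w (QY x.toKIdx (parBY x.toKIdx) U A) (QY x.toKIdx (parBY x.toKIdx) U A))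
    (hγ : 12 * (d + 1) * x.cf ^ 2 * (2 * (10 * (kGeo x.toKIdx).L * ((kGeo x.toKIdx).M * α₀)) * (1 + 10 * (kGeo x.toKIdx).L * ((kGeo x.toKIdx).M * α₀)) *
      Real.exp (4 * (10 * (kGeo x.toKIdx).L * ((kGeo x.toKIdx).M * α₀)))) < γ) :
    PosDefTr (fun _ => (1 : ℝ)) (deltaAY x.toKIdx (parSymY x.toKIdx) (parBY x.toKIdx) (GpY x.toKIdx (parSymY x.toKIdx)) U) := by
  have hM : 0 ≤ (kGeo x.toKIdx).M := by
    show 0 ≤ ((ℓ + 1 : ℕ) : ℝ) * (x.toKIdx.Mh : ℝ)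
    positivity
  have hc : c35Y ≤ 10 := by norm_num [c35Y]
  exact posDefTr_deltaAY_parSymY_of_principal_P x.toKIdx specialUnitaryUnits_le_unitaryUnits hc (mul_nonneg hM hα₀) h.1 hcoer hγ

end MemberFace

/-! ## §4 (v1.1, g23) The LEVELLED plaquette bound for EVERY plaquette from print's class — §2 with the scale factor kept

node00-def-Y RULING-W (R-W0) (pub-ymgap INBOX 2026-08-28 11:41Z): at the record's P-class the «plaquette window near □̃» of the width seats' second-order files is a
THEOREM; dag-n06-w1 g5's adapter `window_of_levelled_holY` (INTENT-1b, 11:53Z) consumes it in the LEVELLED shape `‖U(∂p) − 1‖ ≤ C₀·((L^{lev x − 1})⁻¹)²` for every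
plaquette.  This section prints exactly that shape: §1's covering triple of the plaquette at `x` has index `j′ ∈ {lev x, lev x − 1}`, so §2's scale factor
`(L^{j′})⁻²` is at most `(L^{lev x − 1})⁻²`, with the member-uniform constant `C₀ = 2K(1+K)e^{4K}`, `K = 10L·(M·α₀)`.  APPEND-ONLY: §1–§3 byte-identical. -/

section Levelled

open scoped Matrix.Norms.L2Operator
open B9Eq335PlaquetteAtLettersY B9PinMembersKLevelV1 B9PinGeometryKLevelV1

variable {d ℓ : ℕ} {hd : 1 ≤ d + 1} {hL : Odd (ℓ + 1) ∧ 1 < ℓ + 1} {b₀ b₁ : ℝ} {Mstar N : ℕ}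

/-- ★★★ **PRINT'S (3.35) BOUNDS EVERY PLAQUETTE, LEVELLED** (def-Y's `bg9KP`, threshold `c ≤ 10`, `M·α₀ ≥ 0`, `N ≥ 1`): with `K := 10·L·(M·α₀)`, for EVERY plaquette
`p` based at `x`, `|U(∂p) − 1| ≤ 2K(1+K)e^{4K}·(L^{lev x − 1})⁻²` — §1's covering P-triple `(□, j′, n)` (`j′ ∈ {lev x, lev x − 1}`, `n ≤ 10L`) carries the per-cube datum at
the scale `L^{j′}η`, `norm_holY_sub_one_le_of_reg335Cube` reads `2C(1+C)e^{4C}·(η∕L^{j′}η)²` off it, and `(L^{j′})⁻¹ ≤ (L^{lev x − 1})⁻¹`.  Print, PARAPHRASED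
(our reading of (3.69) p. 404 L15, which displays the two bounds `|Re U(∂p) − 1| ≤ …`, `|Im U(∂p)| ≤ …` of size O(1)Mα₀(Lʲη)⁻² for plaquettes `p ⊂ Bʲ`; NOT a verbatim
line — the verbatim words are only «… follow directly from the assumptions (3.35), (3.37)»): the plaquette variables of a bond of `Ω_j` are within O(1)Mα₀(Lʲη)⁻² of `1`;
here with the located index shift by one at thin features (v1.2: doc-only re-marking of this gloss, referee ref-A g30 NIT-CITE-1; statement and proof unchanged).
[cite: Balaban1985BackgroundPropagators, (3.69) p.404, (3.35) p.396] -/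
theorem norm_holY_sub_one_le_levelled_of_reg335P [Nonempty (Fin N)] (i : KIdx d ℓ hd hL b₀ b₁) {G : Subgroup (Matrix (Fin N) (Fin N) ℂ)ˣ}
    (U : CfgY (Matrix (Fin N) (Fin N) ℂ) i) {c α₀ : ℝ} (hc : c ≤ 10) (hMα : 0 ≤ (kGeo i).M * α₀)
    (h : (bg9KP (Matrix (Fin N) (Fin N) ℂ) G i).Reg335 c α₀ U) (p : PlaqY i) :
    ‖((holY i U p : (Matrix (Fin N) (Fin N) ℂ)ˣ) : Matrix (Fin N) (Fin N) ℂ) - 1‖ ≤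
      2 * (10 * (kGeo i).L * ((kGeo i).M * α₀)) * (1 + 10 * (kGeo i).L * ((kGeo i).M * α₀)) * Real.exp (4 * (10 * (kGeo i).L * ((kGeo i).M * α₀)))
        * (((kGeo i).L ^ (levV1 i p.src - 1))⁻¹) ^ 2 := by
  obtain ⟨q, hq, ⟨hx, hxμ, hxν, -⟩, hlev, hn⟩ := exists_cubeClassP_plaquette i hc p.src p.μ p.ν
  have hcube := reg335CubeP_of_reg335P (𝔸 := Matrix (Fin N) (Fin N) ℂ) (G := G) i h hq
  have hη := eta_pos i
  have hL1 := one_le_L i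
  have hL0 : 0 < (kGeo i).L := lt_of_lt_of_le one_pos hL1
  have hLj : (1 : ℝ) ≤ (kGeo i).L ^ q.2.1 := one_le_pow₀ hL1
  have hj : (kGeo i).eta ≤ LatticeNorms.scaleLen (kGeo i).L (kGeo i).eta q.2.1 := by
    unfold LatticeNorms.scaleLen; nlinarith
  have hC0 : 0 ≤ (q.2.2 : ℝ) * ((kGeo i).M * α₀) := mul_nonneg (Nat.cast_nonneg _) hMα
  have key := norm_holY_sub_one_le_of_reg335Cube i U hη hj hC0 hcube p hx hxμ hxν
  have hratio : (kGeo i).eta / LatticeNorms.scaleLen (kGeo i).L (kGeo i).eta q.2.1 = ((kGeo i).L ^ q.2.1)⁻¹ := by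
    have hη0 : (kGeo i).eta ≠ 0 := hη.ne'
    unfold LatticeNorms.scaleLen
    rw [div_mul_eq_div_div_swap, div_self hη0, one_div]
  rw [hratio] at key
  -- the covering index `j′ ≥ lev x − 1`, so `(L^{j′})⁻¹ ≤ (L^{lev x − 1})⁻¹`
  have hjlev : levV1 i p.src - 1 ≤ q.2.1 := by rcases hlev with h1 | h1 <;> omega
  have hpow : ((kGeo i).L ^ q.2.1)⁻¹ ≤ ((kGeo i).L ^ (levV1 i p.src - 1))⁻¹ :=
    inv_anti₀ (pow_pos hL0 _) (pow_le_pow_right₀ hL1 hjlev)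
  have hpow0 : 0 ≤ ((kGeo i).L ^ q.2.1)⁻¹ := inv_nonneg.2 (le_trans zero_le_one hLj)
  have hsq : (((kGeo i).L ^ q.2.1)⁻¹) ^ 2 ≤ (((kGeo i).L ^ (levV1 i p.src - 1))⁻¹) ^ 2 := pow_le_pow_left₀ hpow0 hpow 2
  have hnL : (q.2.2 : ℝ) ≤ 10 * (kGeo i).L := by
    show (q.2.2 : ℝ) ≤ 10 * ((ℓ + 1 : ℕ) : ℝ)
    exact_mod_cast hn
  have hCC : (q.2.2 : ℝ) * ((kGeo i).M * α₀) ≤ 10 * (kGeo i).L * ((kGeo i).M * α₀) := mul_le_mul_of_nonneg_right hnL hMα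
  have hmono := plaqBound_mono hC0 hCC
  have hB0 : 0 ≤ 2 * ((q.2.2 : ℝ) * ((kGeo i).M * α₀)) * (1 + (q.2.2 : ℝ) * ((kGeo i).M * α₀)) * Real.exp (4 * ((q.2.2 : ℝ) * ((kGeo i).M * α₀))) := by
    have := Real.exp_pos (4 * ((q.2.2 : ℝ) * ((kGeo i).M * α₀))); positivity
  have hB1 : 0 ≤ (((kGeo i).L ^ (levV1 i p.src - 1))⁻¹) ^ 2 := sq_nonneg _
  calc _ ≤ 2 * ((q.2.2 : ℝ) * ((kGeo i).M * α₀)) * (1 + (q.2.2 : ℝ) * ((kGeo i).M * α₀)) * Real.exp (4 * ((q.2.2 : ℝ) * ((kGeo i).M * α₀))) *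
        (((kGeo i).L ^ q.2.1)⁻¹) ^ 2 := key
    _ ≤ 2 * ((q.2.2 : ℝ) * ((kGeo i).M * α₀)) * (1 + (q.2.2 : ℝ) * ((kGeo i).M * α₀)) * Real.exp (4 * ((q.2.2 : ℝ) * ((kGeo i).M * α₀))) *
        (((kGeo i).L ^ (levV1 i p.src - 1))⁻¹) ^ 2 := mul_le_mul_of_nonneg_left hsq hB0
    _ ≤ _ := mul_le_mul_of_nonneg_right hmono hB1

/-- ★★★ **MEMBER FORM of the levelled bound** (def-Y's `bg9YP`, sequence `{Ω_j}` = the member's own index; `α₀ ≥ 0`): for every plaquette `p` of the member,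
`|U(∂p) − 1| ≤ 2K(1+K)e^{4K}·(L^{lev x − 1})⁻²`, `K = 10L·(M·α₀)`. [cite: Balaban1985BackgroundPropagators, (3.69) p.404, (3.35) p.396] -/
theorem norm_holY_sub_one_le_levelled_of_regYP335 [Nonempty (Fin N)] (x : MemberY d ℓ hd hL b₀ b₁ Mstar) {G : Subgroup (Matrix (Fin N) (Fin N) ℂ)ˣ}
    {U : (bg9YP (Matrix (Fin N) (Fin N) ℂ) G x).Cfg} {c α₀ : ℝ} (hc : c ≤ 10) (hα₀ : 0 ≤ α₀)
    (h : (bg9YP (Matrix (Fin N) (Fin N) ℂ) G x).Reg335 c α₀ U) (p : PlaqY x.toKIdx) :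
    ‖((holY x.toKIdx U p : (Matrix (Fin N) (Fin N) ℂ)ˣ) : Matrix (Fin N) (Fin N) ℂ) - 1‖ ≤
      2 * (10 * (kGeo x.toKIdx).L * ((kGeo x.toKIdx).M * α₀)) * (1 + 10 * (kGeo x.toKIdx).L * ((kGeo x.toKIdx).M * α₀)) *
          Real.exp (4 * (10 * (kGeo x.toKIdx).L * ((kGeo x.toKIdx).M * α₀)))
        * (((kGeo x.toKIdx).L ^ (levV1 x.toKIdx p.src - 1))⁻¹) ^ 2 := by
  have hM : 0 ≤ (kGeo x.toKIdx).M := by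
    show 0 ≤ ((ℓ + 1 : ℕ) : ℝ) * (x.toKIdx.Mh : ℝ)
    positivity
  exact norm_holY_sub_one_le_levelled_of_reg335P x.toKIdx U hc (mul_nonneg hM hα₀) h.1 p

/-- ★ the member form at the N06 certificate's literal premise `(bg9YP … x).Reg335 c35Y α₀ U` (MODULE 4's `c35Y = 10`).
[cite: Balaban1985BackgroundPropagators, (3.69) p.404, (3.35) p.396 («≧ 10»)] -/
theorem norm_holY_sub_one_le_levelled_of_regYP335_c35Y [Nonempty (Fin N)] (x : MemberY d ℓ hd hL b₀ b₁ Mstar) {G : Subgroup (Matrix (Fin N) (Fin N) ℂ)ˣ}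
    {U : (bg9YP (Matrix (Fin N) (Fin N) ℂ) G x).Cfg} {α₀ : ℝ} (hα₀ : 0 ≤ α₀)
    (h : (bg9YP (Matrix (Fin N) (Fin N) ℂ) G x).Reg335 c35Y α₀ U) (p : PlaqY x.toKIdx) :
    ‖((holY x.toKIdx U p : (Matrix (Fin N) (Fin N) ℂ)ˣ) : Matrix (Fin N) (Fin N) ℂ) - 1‖ ≤
      2 * (10 * (kGeo x.toKIdx).L * ((kGeo x.toKIdx).M * α₀)) * (1 + 10 * (kGeo x.toKIdx).L * ((kGeo x.toKIdx).M * α₀)) *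
          Real.exp (4 * (10 * (kGeo x.toKIdx).L * ((kGeo x.toKIdx).M * α₀)))
        * (((kGeo x.toKIdx).L ^ (levV1 x.toKIdx p.src - 1))⁻¹) ^ 2 :=
  norm_holY_sub_one_le_levelled_of_regYP335 x (by norm_num [c35Y]) hα₀ h p

end Levelled

end Literature.MathematicalPhysics.QuantumFieldTheory.Balaban1983to89.B9Eq335CoveragePAtLettersY
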